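import Summits.Schanuel.Schanuel.Theorems.ZilberEacLogTranscendence
import Mathlib.RingTheory.EuclideanDomain
import Mathlib.Analysis.Calculus.Deriv.Mul
import Mathlib.Analysis.Calculus.Deriv.Inv
import Mathlib.Analysis.Analytic.Constructions
import Mathlib.Analysis.Complex.Polynomial.Basic
import HarnessLib

/-!
# The equimodular class, XXVIII (tools): Vieta for distinct roots, the logarithmic derivative of a
# product of branches, and the coprime reduction of a non-constant ratio of polynomials

HONEST FRAMING.  Cell `pub-schanuel` (Zilber's Exponential-Algebraic Closedness, case ladder;
host summit Schanuel), seat 2, gen 24.  Elementary tools for the branch-sum argument of file XXIX: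
* `eq_C_mul_prod_of_roots` / `eval_zero_eq_of_roots`: a polynomial of degree `r` with `r` given
  distinct roots is `lc · ∏ (X - y)`, so its constant term is `lc · (-1)^r ∏ y` (Vieta);
* `sum_deriv_div_eq_logDeriv`: if `∏_i f_i = c·B/A` near `z` (all `f_i` analytic and nonzero at
  `z`), then `Σ_i f_i'(z)/f_i(z) = (A B' - A' B)(z)/(A B)(z)`;
* `exists_coprime_logDeriv`: for nonzero `A₀, B₀ ∈ ℂ[X]` with `B₀/A₀` non-constant there are
  coprime `A, B` with the same logarithmic derivative of the ratio and a point that is a root of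
  exactly one of them (the hypothesis of gen 22 file II, `not_algebraic_of_hasDerivAt_logDeriv`).
[folklore]; nothing here is specific to Schanuel's conjecture (neither used nor implied).
-/

noncomputable section

open Filter Topology Polynomial

set_option linter.dupNamespace false

namespace Summit.Schanuel.Schanuel.Theorems

/-! ## Part A. Vieta for a full set of distinct roots -/

/-- **A polynomial with `deg q` distinct given roots factors over them.** [folklore] -/
theorem eq_C_mul_prod_of_roots (q : ℂ[X]) (hq : q ≠ 0) (s : Finset ℂ) (hs : ∀ y ∈ s, q.IsRoot y)
    (hcard : s.card = q.natDegree) :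
    q = C q.leadingCoeff * ∏ y ∈ s, (X - C y) := by
  classical
  set m : ℂ[X] := ∏ y ∈ s, (X - C y) with hm
  have hmonic : m.Monic := monic_prod_of_monic _ _ fun y _ => monic_X_sub_C y
  have hmdeg : m.natDegree = s.card := by
    rw [hm, natDegree_finsetProd_X_sub_C_eq_card]
  have hlc : q.leadingCoeff ≠ 0 := leadingCoeff_ne_zero.2 hq
  have hR0 : C q.leadingCoeff * m ≠ 0 := mul_ne_zero (by rwa [Ne, C_eq_zero]) hmonic.ne_zero
  have hRdeg : (C q.leadingCoeff * m).natDegree = q.natDegree := by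
    rw [natDegree_C_mul hlc, hmdeg, hcard]
  have hRlc : (C q.leadingCoeff * m).leadingCoeff = q.leadingCoeff := by
    rw [leadingCoeff_mul, leadingCoeff_C, hmonic.leadingCoeff, mul_one]
  set D := q - C q.leadingCoeff * m with hD
  by_contra hne
  have hD0 : D ≠ 0 := sub_ne_zero.2 hne
  have hdeg : D.degree < q.degree := by
    refine degree_sub_lt ?_ hq hRlc.symm
    rw [degree_eq_natDegree hq, degree_eq_natDegree hR0, hRdeg]
  have hnat : D.natDegree < s.card := by
    rw [hcard]; exact natDegree_lt_natDegree hD0 hdeg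
  refine hD0 (eq_zero_of_natDegree_lt_card_of_eval_eq_zero' D s (fun y hy => ?_) hnat)
  rw [hD, eval_sub, (hs y hy).eq_zero, eval_mul, eval_C, eval_prod, Finset.prod_eq_zero hy (by simp),
    mul_zero, sub_zero]

/-- **Vieta for the constant term**: `q(0) = lc(q) · (-1)^r · ∏ y`. [folklore] -/
theorem eval_zero_eq_of_roots (q : ℂ[X]) (hq : q ≠ 0) (s : Finset ℂ) (hs : ∀ y ∈ s, q.IsRoot y)
    (hcard : s.card = q.natDegree) :
    q.eval 0 = q.leadingCoeff * (-1) ^ s.card * ∏ y ∈ s, y := by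
  conv_lhs => rw [eq_C_mul_prod_of_roots q hq s hs hcard]
  rw [eval_mul, eval_C, eval_prod, mul_assoc]
  congr 1
  simp only [eval_sub, eval_X, eval_C, zero_sub]
  rw [← Finset.prod_const, ← Finset.prod_mul_distrib]
  exact Finset.prod_congr rfl fun y _ => by ring

/-! ## Part B. The logarithmic derivative of a product of branches -/

/-- **`Σ f_i'/f_i = (A B' - A' B)/(A B)` when `∏ f_i = c·B/A` near `z`.** [folklore] -/
theorem sum_deriv_div_eq_logDeriv {ι : Type*} (s : Finset ι) {f : ι → ℂ → ℂ} {z : ℂ}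
    (hf : ∀ i ∈ s, AnalyticAt ℂ (f i) z) (hf0 : ∀ i ∈ s, f i z ≠ 0) (A B : ℂ[X]) (c : ℂ)
    (hA : A.eval z ≠ 0) (hB : B.eval z ≠ 0) (hc : c ≠ 0)
    (heq : ∀ᶠ y in 𝓝 z, ∏ i ∈ s, f i y = c * B.eval y / A.eval y) :
    ∑ i ∈ s, deriv (f i) z / f i z =
      (A * derivative B - derivative A * B).eval z / (A * B).eval z := by
  classical
  -- derivative of the product of the branches
  have hprod : HasDerivAt (fun y => ∏ i ∈ s, f i y)
      (∑ i ∈ s, (∏ j ∈ s.erase i, f j z) • deriv (f i) z) z :=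
    HasDerivAt.fun_finsetProd fun i hi => (hf i hi).differentiableAt.hasDerivAt
  have hP0 : ∏ j ∈ s, f j z ≠ 0 := Finset.prod_ne_zero_iff.2 hf0
  have hsum : ∑ i ∈ s, (∏ j ∈ s.erase i, f j z) • deriv (f i) z =
      (∏ j ∈ s, f j z) * ∑ i ∈ s, deriv (f i) z / f i z := by
    rw [Finset.mul_sum]
    refine Finset.sum_congr rfl fun i hi => ?_
    rw [smul_eq_mul, ← Finset.prod_erase_mul s (fun j => f j z) hi]
    field_simp [hf0 i hi]
  rw [hsum] at hprod
  -- derivative of the rational function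
  have hrat : HasDerivAt (fun y => c * B.eval y / A.eval y)
      ((c * (derivative B).eval z * A.eval z - c * B.eval z * (derivative A).eval z) / A.eval z ^ 2) z :=
    ((Polynomial.hasDerivAt B z).const_mul c).div (Polynomial.hasDerivAt A z) hA
  have heq' : (fun y => c * B.eval y / A.eval y) =ᶠ[𝓝 z] fun y => ∏ i ∈ s, f i y :=
    heq.mono fun y hy => hy.symm
  have huniq := (hprod.congr_of_eventuallyEq heq').unique hrat
  have hPz : ∏ j ∈ s, f j z = c * B.eval z / A.eval z := heq.self_of_nhds
  rw [hPz] at huniq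
  rw [eval_mul, eval_sub, eval_mul, eval_mul]
  have hcBA : c * B.eval z / A.eval z ≠ 0 := div_ne_zero (mul_ne_zero hc hB) hA
  have key : ∑ i ∈ s, deriv (f i) z / f i z =
      ((c * (derivative B).eval z * A.eval z - c * B.eval z * (derivative A).eval z) / A.eval z ^ 2) /
        (c * B.eval z / A.eval z) := by
    rw [← huniq, mul_div_cancel_left₀ _ hcBA]
  rw [key]
  field_simp

/-! ## Part C. Coprime reduction of a non-constant ratio -/

/-- **Coprime reduction.**  `A₀, B₀ ≠ 0` with `B₀ ≠ c·A₀` for every constant `c`: there are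
`A, B, G` with `A₀ = G A`, `B₀ = G B`, a point that is a root of exactly one of `A, B`, and the same
logarithmic derivative of the ratio wherever `A₀ B₀ ≠ 0`. [folklore] -/
theorem exists_coprime_logDeriv {A₀ B₀ : ℂ[X]} (hA₀ : A₀ ≠ 0) (hB₀ : B₀ ≠ 0)
    (hratio : ∀ c : ℂ, B₀ ≠ C c * A₀) :
    ∃ A B : ℂ[X], A ≠ 0 ∧ B ≠ 0 ∧
      (∃ a : ℂ, (A.IsRoot a ∧ ¬ B.IsRoot a) ∨ (B.IsRoot a ∧ ¬ A.IsRoot a)) ∧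
      (∀ z : ℂ, (A₀ * B₀).eval z ≠ 0 → (A * B).eval z ≠ 0) ∧
      ∀ z : ℂ, (A₀ * B₀).eval z ≠ 0 →
        (A₀ * derivative B₀ - derivative A₀ * B₀).eval z / (A₀ * B₀).eval z =
          (A * derivative B - derivative A * B).eval z / (A * B).eval z := by
  classical
  set G : ℂ[X] := EuclideanDomain.gcd A₀ B₀ with hG
  obtain ⟨A, hA⟩ := EuclideanDomain.gcd_dvd_left A₀ B₀
  obtain ⟨B, hB⟩ := EuclideanDomain.gcd_dvd_right A₀ B₀
  rw [← hG] at hA hB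
  have hG0 : G ≠ 0 := fun h => hA₀ (by rw [hA, h, zero_mul])
  have hAne : A ≠ 0 := fun h => hA₀ (by rw [hA, h, mul_zero])
  have hBne : B ≠ 0 := fun h => hB₀ (by rw [hB, h, mul_zero])
  -- `A, B` are coprime (Bézout for the gcd, cancelled by `G`)
  have hcop : IsCoprime A B := by
    set a := EuclideanDomain.gcdA A₀ B₀ with ha
    set b := EuclideanDomain.gcdB A₀ B₀ with hb
    have hbez : G = A₀ * a + B₀ * b := by rw [hG]; exact EuclideanDomain.gcd_eq_gcd_ab A₀ B₀
    refine ⟨a, b, mul_left_cancel₀ hG0 ?_⟩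
    calc G * (a * A + b * B) = A₀ * a + B₀ * b := by rw [hA, hB]; ring
      _ = G * 1 := by rw [mul_one, ← hbez]
  -- a root of exactly one of `A, B`
  have hone : ∃ a : ℂ, (A.IsRoot a ∧ ¬ B.IsRoot a) ∨ (B.IsRoot a ∧ ¬ A.IsRoot a) := by
    have hnot_both : ∀ a, A.IsRoot a → B.IsRoot a → False := by
      intro a ha hb
      obtain ⟨u, v, huv⟩ := hcop
      have := congrArg (Polynomial.eval a) huv
      rw [eval_add, eval_mul, eval_mul, ha.eq_zero, hb.eq_zero, mul_zero, mul_zero, add_zero,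
        eval_one] at this
      exact zero_ne_one this
    by_cases hdA : 0 < A.degree
    · obtain ⟨a, ha⟩ := Complex.exists_root hdA
      exact ⟨a, Or.inl ⟨ha, fun hb => hnot_both a ha hb⟩⟩
    · -- `A` is a nonzero constant, so `B` is not constant
      obtain ⟨cA, hA'⟩ : ∃ cA : ℂ, A = C cA := ⟨_, eq_C_of_degree_le_zero (not_lt.1 hdA)⟩
      have hc0 : cA ≠ 0 := by
        intro h; exact hAne (by rw [hA', h, map_zero])
      by_cases hdB : 0 < B.degree
      · obtain ⟨b, hb⟩ := Complex.exists_root hdB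
        refine ⟨b, Or.inr ⟨hb, fun ha => ?_⟩⟩
        rw [hA', IsRoot, eval_C] at ha
        exact hc0 ha
      · obtain ⟨cB, hB'⟩ : ∃ cB : ℂ, B = C cB := ⟨_, eq_C_of_degree_le_zero (not_lt.1 hdB)⟩
        exfalso
        refine hratio (cB / cA) ?_
        rw [hB, hA, hB', hA', mul_comm (C (cB / cA)) _, mul_assoc, ← C_mul, mul_div_cancel₀ _ hc0]
  refine ⟨A, B, hAne, hBne, hone, fun z hz => ?_, fun z hz => ?_⟩
  · rw [hA, hB] at hz
    rw [eval_mul] at hz ⊢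
    rw [eval_mul, eval_mul] at hz
    intro h
    apply hz
    rcases mul_eq_zero.1 h with h1 | h1
    · rw [h1]; ring
    · rw [h1]; ring
  · have hGz : G.eval z ≠ 0 := by
      intro h; apply hz
      rw [hA, eval_mul, eval_mul, h, zero_mul, zero_mul]
    have hABz : (A * B).eval z ≠ 0 := by
      intro h; apply hz
      rw [eval_mul] at h
      rw [hA, hB, eval_mul, eval_mul, eval_mul]
      rcases mul_eq_zero.1 h with h1 | h1
      · rw [h1]; ring
      · rw [h1]; ring
    rw [div_eq_div_iff hz hABz, hA, hB]
    simp only [derivative_mul, eval_mul, eval_sub, eval_add]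
    ring

end Summit.Schanuel.Schanuel.Theorems
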